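import Literature.Probability.LatticeModels.IsingTopVacuum
import Literature.Probability.LatticeModels.IsingCylinderState
import HarnessLib

/-!
# The in-row correlation of the Ising cylinder state as a `k × k` determinant

Topic `Probability/LatticeModels`, namespace `Literature.Probability.LatticeModels`. Step E4 of the
exact-solution programme behind `Literature.Probability.LatticeModels.onsager_yang`
(`OnsagerToeplitz.torusRowPair_tendsto_toeplitzDet` is the remaining exact input). Combining

* `IsingCylinderState.limUnder_torusRowPair_eq_groundState` — for `β ≥ 0`, `N ≥ 1` and any top
  eigenvector `Ω` of the symmetrised transfer matrix `A`, `lim_M ⟨σ_{(0,0)}σ_{(k,0)}⟩_{p,NM} = ⟨Ω, σᶻ_0σᶻ_k Ω⟩/⟨Ω,Ω⟩`;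
* `IsingTopVacuum.exists_perron_polarizedVacuum` — the Perron vector `Ω` of `A` is a polarized (Fock)
  vacuum of the Ising Majorana family for the raising space / polarization of `IsingPolarization`;
* `QuasiFreeVacuum.expect_prodPairs_div` — Wick's theorem in determinant form;
* `σᶻ_0σᶻ_k = ∏_{i<k} σᶻ_iσᶻ_{i+1} = i^k B_0A_1B_1A_2⋯B_{k-1}A_k` (`IsingMajorana`),

this file proves the classical formula (T. D. Schultz, D. C. Mattis, E. H. Lieb, Rev. Mod. Phys. 36
(1964) 856, §V, eqs. (5.3)–(5.7): "the correlation function in a row … is a Toeplitz determinant";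
E. W. Montroll, R. B. Potts, J. C. Ward, J. Math. Phys. 4 (1963) 308, §§3–4; B. Kaufman, L. Onsager,
Phys. Rev. 76 (1949) 1244):

`limUnder_torusRowPair_eq_det` — for `β > 0`, `N = m + 3` and `k < N`,

  `lim_{M→∞} ⟨σ_{(0,0)}σ_{(k,0)}⟩_{p,NM} = i^k det (G_N(i, j+1))_{i,j<k}`,

with the finite-`N` contractions `G_N(i,j) = ⟨B_iA_j⟩ = N⁻¹ ∑_m e^{iq_m(j-i)} γ_{q_m}/sh_{q_m}` over the
antiperiodic momenta `q_m = (2m+1)π/N` (`cylKernel`). Everything is proved. The identification of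
`i e^{iq} γ_q/sh_q` with Onsager's symbol and the limit `N → ∞` (Riemann sums → Fourier coefficients,
`det` continuous) — i.e. `torusRowPair_tendsto_toeplitzDet` itself — is the next file.
-/

noncomputable section

open Matrix Complex Finset Filter Literature.MathematicalPhysics.FreeFermions Literature.LinearAlgebra.Matrix

open scoped Topology

namespace Literature.Probability.LatticeModels

variable {N : ℕ}

/-! ### The finite-`N` contraction kernel -/

/-- The **finite-`N` contraction** `G_N(i, j) = ⟨B_iA_j⟩ = N⁻¹ ∑_m e^{-iq_mi} e^{iq_mj} γ_{q_m}/sh_{q_m}`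
(sites as natural numbers; SML 1964, §V, eq. (5.4)-type; LSM 1961, eq. (2.29) `G_{ij} = G(j-i)`). [cite: SchultzMattisLieb1964, §V, eqs. (5.3)–(5.7)] -/
def cylKernel (N : ℕ) (β : ℝ) (i j : ℕ) : ℂ :=
  (N : ℂ)⁻¹ * ∑ m : Fin N, starRingEnd ℂ (ph (apMom N m) i) * ph (apMom N m) j *
    (gamQ β (apMom N m) / ((shQ β (apMom N m) : ℝ) : ℂ))

/-! ### `σᶻ_0σᶻ_k` as an interleaved product of Majoranas -/

/-- Pulling scalars out of an ordered product: `∏ (c Xᵢ) = c^k ∏ Xᵢ`. [folklore] -/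
theorem prod_ofFn_smul {R : Type*} [Ring R] [Algebra ℂ R] (c : ℂ) {k : ℕ} (X : Fin k → R) :
    (List.ofFn fun i => c • X i).prod = c ^ k • (List.ofFn X).prod := by
  induction k with
  | zero => simp
  | succ k ih =>
    rw [List.ofFn_succ, List.prod_cons, List.ofFn_succ, List.prod_cons, ih (fun i => X i.succ), smul_mul_smul_comm,
      pow_succ']

/-- **`σᶻ_0σᶻ_k` telescopes into consecutive bonds**: `σᶻ_0σᶻ_k = ∏_{i<k} (σᶻ_iσᶻ_{i+1})`
(`(σᶻ_i)² = 1`). [folklore] -/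
theorem prod_sigmaZC_consecutive {k : ℕ} (hkN : k < N) :
    (List.ofFn fun i : Fin k => sigmaZC (N := N) ⟨i, (Nat.lt_succ_of_lt i.isLt).trans_le hkN⟩ *
        sigmaZC ⟨i + 1, lt_of_le_of_lt (Nat.succ_le_of_lt i.isLt) hkN⟩).prod =
      sigmaZC ⟨0, lt_of_le_of_lt (Nat.zero_le k) hkN⟩ * sigmaZC ⟨k, hkN⟩ := by
  induction k with
  | zero => rw [List.ofFn_zero, List.prod_nil, sigmaZC_mul_sigmaZC]
  | succ k ih =>
    rw [List.ofFn_succ', List.prod_concat]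
    have ih' := ih ((Nat.lt_succ_self k).trans hkN)
    simp only [Fin.val_castSucc, Fin.val_last] at ih' ⊢
    rw [ih', mul_assoc, ← mul_assoc (sigmaZC ⟨k, _⟩) (sigmaZC ⟨k, _⟩), sigmaZC_mul_sigmaZC, one_mul]

/-- **`σᶻ_0σᶻ_k = i^k B_0A_1B_1A_2⋯B_{k-1}A_k`** as an interleaved product of the Ising Majoranas
(SML 1964, §V, eq. (5.2): `σ_1^xσ_{1+n}^x` as a product of `2n` fermion factors). [cite: SchultzMattisLieb1964, §V, eqs. (5.1)–(5.3)] -/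
theorem sigmaZC_zero_mul_sigmaZC_eq_prodPairs {k : ℕ} (hkN : k < N) :
    sigmaZC (N := N) ⟨0, lt_of_le_of_lt (Nat.zero_le k) hkN⟩ * sigmaZC ⟨k, hkN⟩ =
      I ^ k • prodPairs (isingMajorana N) (fun i : Fin k => Sum.inr ⟨i, i.isLt.trans hkN⟩)
        (fun i : Fin k => Sum.inl ⟨i + 1, lt_of_le_of_lt (Nat.succ_le_of_lt i.isLt) hkN⟩) := by
  rw [← prod_sigmaZC_consecutive hkN, prodPairs, ← prod_ofFn_smul]
  congr 2
  funext i
  rw [isingMajorana_inr, isingMajorana_inl, sigmaZC_mul_sigmaZC_succ_eq_majorana rfl]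

/-! ### The determinant formula -/

/-- The diagonal pair observable over `ℂ` is `σᶻ_0σᶻ_k`. [folklore] -/
theorem diagonal_rowPairObs_eq {k : ℕ} (hkN : k < N) :
    (diagonal fun r : Row N => ((rowPairObs N k (lt_of_le_of_lt (Nat.zero_le k) hkN) r : ℝ) : ℂ)) =
      sigmaZC ⟨0, lt_of_le_of_lt (Nat.zero_le k) hkN⟩ * sigmaZC ⟨k, hkN⟩ := by
  rw [sigmaZC_mul_sigmaZC_eq_diagonal]
  congr 1
  funext r
  unfold rowPairObs
  congr 3
  exact Fin.ext (Nat.mod_eq_of_lt hkN)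

/-- A real ground-state ratio as a complex expectation: for real `Ω` and a real diagonal `d`,
`(∑ d_r Ω_r²)/(∑ Ω_r²) = ⟨Ω_ℂ, diag(d) Ω_ℂ⟩/⟨Ω_ℂ, Ω_ℂ⟩`. [folklore] -/
theorem ofReal_sum_mul_sq_div (d Ω : Row N → ℝ) :
    (((∑ r, d r * Ω r ^ 2) / ∑ r, Ω r ^ 2 : ℝ) : ℂ) =
      star (fun r => (Ω r : ℂ)) ⬝ᵥ ((diagonal fun r => (d r : ℂ)) *ᵥ fun r => (Ω r : ℂ)) /
        (star (fun r => (Ω r : ℂ)) ⬝ᵥ fun r => (Ω r : ℂ)) := by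
  push_cast
  congr 1
  · rw [dotProduct]
    refine sum_congr rfl fun r _ => ?_
    rw [mulVec_diagonal, Pi.star_apply, Complex.star_def, Complex.conj_ofReal]
    ring
  · rw [dotProduct]
    refine sum_congr rfl fun r _ => ?_
    rw [Pi.star_apply, Complex.star_def, Complex.conj_ofReal]
    ring

/-- The contraction matrix of the bond string is the kernel `G_N(i, j+1)`. [folklore] -/
theorem contractionMatrix_bond_eq (β : ℝ) {k : ℕ} (hkN : k < N) :
    contractionMatrix (pol N β) (fun i : Fin k => Sum.inr ⟨i, i.isLt.trans hkN⟩)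
        (fun i : Fin k => Sum.inl ⟨i + 1, lt_of_le_of_lt (Nat.succ_le_of_lt i.isLt) hkN⟩) =
      Matrix.of fun i j : Fin k => cylKernel N β i (j + 1) := by
  ext i j
  rw [contractionMatrix_apply, two_mul_pol_single_inr_inl, Matrix.of_apply, cylKernel]

/-- **The in-row correlation of the cylinder state is a `k × k` determinant** (SML 1964, §V,
eqs. (5.3)–(5.7); Montroll–Potts–Ward 1963, §§3–4; Kaufman–Onsager 1949): for `β > 0`, `N = m+3` and
`k < N`, `lim_{M→∞} ⟨σ_{(0,0)}σ_{(k,0)}⟩_{p,NM} = i^k det (G_N(i, j+1))_{i,j<k}` with the finite-`N`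
contractions `G_N = cylKernel N β`. Proof: the limit is the Perron ground-state expectation of
`σᶻ_0σᶻ_k = i^k B_0A_1⋯B_{k-1}A_k`; the Perron vector is the Fock vacuum of the raising modes; Wick's
theorem in determinant form with `⟨B_iB_j⟩ = δ_ij`. [cite: SchultzMattisLieb1964, §V, eqs. (5.3)–(5.7)] -/
theorem limUnder_torusRowPair_eq_det {β : ℝ} (hβ : 0 < β) (m k : ℕ) (hkN : k < m + 3) :
    ((limUnder atTop fun M : ℕ => torusRowPair β (m + 3) M k : ℝ) : ℂ) =
      I ^ k * (Matrix.of fun i j : Fin k => cylKernel (m + 3) β i (j + 1)).det := by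
  obtain ⟨Ω, hΩ, hAΩ, hvac⟩ := exists_perron_polarizedVacuum (N := m + 3) hβ
  -- `Ω` is a top eigenvector of the tree's `symTransfer`
  have hAΩ' : symTransfer (m + 3) β *ᵥ Ω = topEigenvalue (symTransfer_posSemidef (N := m + 3) hβ.le).1 • Ω := by
    rw [topEigenvalue_congr (symTransfer_posSemidef (N := m + 3) hβ.le).1 (symTransferTw_isHermitian β 1)
      (symTransfer_eq_symTransferTw m β), symTransfer_eq_symTransferTw]
    exact hAΩ
  have hΩ0 : Ω ≠ 0 := fun h => (hΩ (fun _ => 1)).ne' (by rw [h]; rfl)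
  have hΩC0 : (fun r => (Ω r : ℂ)) ≠ 0 := by
    intro h
    have h1 : ((Ω fun _ => 1 : ℝ) : ℂ) = 0 := congr_fun h (fun _ => 1)
    exact (hΩ _).ne' (Complex.ofReal_eq_zero.1 h1)
  have hN : 0 < m + 3 := lt_of_le_of_lt (Nat.zero_le k) hkN
  rw [limUnder_torusRowPair_eq_groundState hβ.le hN k hΩ0 hAΩ', ofReal_sum_mul_sq_div,
    diagonal_rowPairObs_eq hkN, sigmaZC_zero_mul_sigmaZC_eq_prodPairs hkN, smul_mulVec, dotProduct_smul,
    smul_eq_mul, mul_div_assoc,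
    expect_prodPairs_div (isMajoranaFamily_isingMajorana (m + 3)) hvac hΩC0 _ _ (fun i j => Sum.inr_ne_inl)
      (fun i j h => Fin.ext (Fin.mk.inj_iff.1 (Sum.inr_injective h))) (fun i j hij => ?_),
    contractionMatrix_bond_eq β hkN]
  exact pol_single_inr_inr_of_ne β fun h => hij (Fin.ext (Fin.mk.inj_iff.1 h))

end Literature.Probability.LatticeModels
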